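import Mathlib.Analysis.InnerProductSpace.PiL2
import HarnessLib

/-!
# Mid-plane transversal: a lattice line close to the axis of a slab sample meets the sample

HONEST FRAMING. Part of the venture `Summits/Ventures/Crystal3D` (cell `crystal3d-full`).
Elementary inner-product geometry in `ℝ³`; nothing about packings or ground states.

Setting of the cell's `LatticeNoGain` / `NoReconstructionGain` (HOME/cf-p1/ROUTE.md §12.4, §33,
P1-SPEC-A step (L2)): a unit normal `ν`, the SLAB SAMPLE `{p : −2R ≤ ⟪p, ν⟫ ≤ −R, ‖p‖² − ⟪p, ν⟫² ≤ ρ²}`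
(thickness `R`, lateral radius `ρ` about the axis `ℝν`), and a line `t ↦ P₀ + t W` (`t ∈ ℤ`,
`‖W‖ ≤ 1`, `⟪W, ν⟫ ≠ 0`: a bond line of the lattice transverse to the slab).  Let `Q` be the point
where the line crosses the mid-plane `⟪·, ν⟫ = −3R/2`.

**Theorem** (`exists_int_mem_slabSample`). If `R ≥ 1` and the lateral distance of `Q` from the axis
is at most `ρ − 1` (`‖Q‖² − ⟪Q, ν⟫² ≤ (ρ − 1)²`, `ρ ≥ 1`), then some INTEGER parameter `t` puts
`P₀ + t W` inside the slab sample: round the real parameter of `Q`; the height moves by at most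
`|⟪W, ν⟫|/2 ≤ 1/2 ≤ R/2` and the lateral position by at most `‖W‖/2 ≤ 1/2`.

So the number of bond lines of one direction meeting the sample is at least the number of lines
whose mid-plane crossing lies in the disc of radius `ρ − 1` — an affine image of `ℤ²`, counted by
`AffineDiscCount.lean` (step (L3), not done here); with the shadow bound `FccShadowBound.lean`
(step (L1)) this is the route to `LatticeNoGain` at a general normal.

WHAT THIS IS NOT: no lattice, no counting; rung F-C1 not moved.
-/

noncomputable section

namespace Summit.Ventures.Crystal3D

open RealInnerProductSpace

/-- The lateral part `v − ⟪v, ν⟫ ν` of `v` (orthogonal projection off a unit vector `ν`) has squared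
norm `‖v‖² − ⟪v, ν⟫²`. -/
theorem norm_sub_inner_smul_sq {V : Type*} [NormedAddCommGroup V] [InnerProductSpace ℝ V]
    (ν v : V) (hν : ‖ν‖ = 1) : ‖v - ⟪v, ν⟫ • ν‖ ^ 2 = ‖v‖ ^ 2 - ⟪v, ν⟫ ^ 2 := by
  rw [@norm_sub_sq_real, norm_smul, hν, mul_one, Real.norm_eq_abs, sq_abs, inner_smul_right,
    real_inner_comm ν v]
  ring

/-- **Mid-plane transversal.** `ν` a unit vector, `W` a direction with `‖W‖ ≤ 1` and
`⟪W, ν⟫ ≠ 0`, `R ≥ 1`, `ρ ≥ 1`.  If the crossing point `Q = P₀ + s W` of the line `P₀ + ℝ W`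
with the mid-plane `⟪·, ν⟫ = −3R/2` satisfies `‖Q‖² − ⟪Q, ν⟫² ≤ (ρ − 1)²`, then for some integer
`t` the point `P₀ + t W` lies in the slab sample:
`−2R ≤ ⟪P₀ + tW, ν⟫ ≤ −R` and `‖P₀ + tW‖² − ⟪P₀ + tW, ν⟫² ≤ ρ²`. -/
theorem exists_int_mem_slabSample (ν P₀ W : EuclideanSpace ℝ (Fin 3)) (hν : ‖ν‖ = 1)
    (hW : ‖W‖ ≤ 1) (hα : ⟪W, ν⟫ ≠ 0) (R ρ : ℝ) (hR : 1 ≤ R) (hρ : 1 ≤ ρ)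
    (hQ : ‖P₀ + (-(⟪P₀, ν⟫ + 3 * R / 2) / ⟪W, ν⟫) • W‖ ^ 2 -
      ⟪P₀ + (-(⟪P₀, ν⟫ + 3 * R / 2) / ⟪W, ν⟫) • W, ν⟫ ^ 2 ≤ (ρ - 1) ^ 2) :
    ∃ t : ℤ, -(2 * R) ≤ ⟪P₀ + (t : ℝ) • W, ν⟫ ∧ ⟪P₀ + (t : ℝ) • W, ν⟫ ≤ -R ∧
      ‖P₀ + (t : ℝ) • W‖ ^ 2 - ⟪P₀ + (t : ℝ) • W, ν⟫ ^ 2 ≤ ρ ^ 2 := by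
  set α : ℝ := ⟪W, ν⟫ with hαdef
  set s : ℝ := -(⟪P₀, ν⟫ + 3 * R / 2) / α with hs
  set Q : EuclideanSpace ℝ (Fin 3) := P₀ + s • W with hQdef
  -- the crossing point lies on the mid-plane
  have hQν : ⟪Q, ν⟫ = -(3 * R / 2) := by
    rw [hQdef, inner_add_left, inner_smul_left, hs]
    simp only [RCLike.conj_to_real]
    field_simp
    ring
  -- |α| ≤ 1
  have hαle : |α| ≤ 1 := by
    have h := abs_real_inner_le_norm W ν
    rw [hν, mul_one] at h
    exact h.trans hW
  -- round the parameter
  set t : ℤ := ⌊s + 1 / 2⌋ with ht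
  have hδ : |(t : ℝ) - s| ≤ 1 / 2 := by
    rw [abs_le]
    constructor <;> linarith [Int.floor_le (s + 1 / 2), Int.lt_floor_add_one (s + 1 / 2)]
  set δ : ℝ := (t : ℝ) - s with hδdef
  have hP : P₀ + (t : ℝ) • W = Q + δ • W := by
    rw [hQdef, hδdef, add_assoc, ← add_smul]; congr 1; ring
  refine ⟨t, ?_, ?_, ?_⟩
  · -- height ≥ -2R
    rw [hP, inner_add_left, inner_smul_left, hQν]
    simp only [RCLike.conj_to_real]
    have : |δ * α| ≤ 1 / 2 := by
      rw [abs_mul]; nlinarith [abs_nonneg δ, abs_nonneg α]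
    have h1 := (abs_le.1 this).1
    linarith
  · -- height ≤ -R
    rw [hP, inner_add_left, inner_smul_left, hQν]
    simp only [RCLike.conj_to_real]
    have : |δ * α| ≤ 1 / 2 := by
      rw [abs_mul]; nlinarith [abs_nonneg δ, abs_nonneg α]
    have h1 := (abs_le.1 this).2
    linarith
  · -- lateral distance ≤ ρ
    rw [hP, ← norm_sub_inner_smul_sq ν _ hν]
    have hsplit : Q + δ • W - ⟪Q + δ • W, ν⟫ • ν = (Q - ⟪Q, ν⟫ • ν) + δ • (W - ⟪W, ν⟫ • ν) := by
      rw [inner_add_left, inner_smul_left]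
      simp only [RCLike.conj_to_real]
      rw [add_smul, smul_sub, smul_smul]
      abel
    rw [hsplit]
    have hρ1 : 0 ≤ ρ - 1 := by linarith
    have hlatQ : ‖Q - ⟪Q, ν⟫ • ν‖ ≤ ρ - 1 := by
      have h2 : ‖Q - ⟪Q, ν⟫ • ν‖ ^ 2 ≤ (ρ - 1) ^ 2 := by
        rw [norm_sub_inner_smul_sq ν _ hν]; exact hQ
      exact (pow_le_pow_iff_left₀ (norm_nonneg _) hρ1 two_ne_zero).1 h2
    have hlatW : ‖W - ⟪W, ν⟫ • ν‖ ≤ 1 := by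
      have h2 : ‖W - ⟪W, ν⟫ • ν‖ ^ 2 ≤ 1 ^ 2 := by
        rw [norm_sub_inner_smul_sq ν _ hν]
        have hW2 : ‖W‖ ^ 2 ≤ 1 := by nlinarith [norm_nonneg W]
        nlinarith [sq_nonneg ⟪W, ν⟫]
      exact (pow_le_pow_iff_left₀ (norm_nonneg _) zero_le_one two_ne_zero).1 h2
    have htri : ‖(Q - ⟪Q, ν⟫ • ν) + δ • (W - ⟪W, ν⟫ • ν)‖ ≤ ρ := by
      calc ‖(Q - ⟪Q, ν⟫ • ν) + δ • (W - ⟪W, ν⟫ • ν)‖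
          ≤ ‖Q - ⟪Q, ν⟫ • ν‖ + ‖δ • (W - ⟪W, ν⟫ • ν)‖ := norm_add_le _ _
        _ = ‖Q - ⟪Q, ν⟫ • ν‖ + |δ| * ‖W - ⟪W, ν⟫ • ν‖ := by rw [norm_smul, Real.norm_eq_abs]
        _ ≤ (ρ - 1) + 1 / 2 * 1 := by
            gcongr
        _ ≤ ρ := by linarith
    have h0 : 0 ≤ ‖(Q - ⟪Q, ν⟫ • ν) + δ • (W - ⟪W, ν⟫ • ν)‖ := norm_nonneg _
    nlinarith

end Summit.Ventures.Crystal3D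

end
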